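/-
Copyright: public-audit package `pub-balaban` (b2b-balaban), seat pv16-g20. Released under Apache 2.0 like Mathlib.
-/
import Literature.MathematicalPhysics.QuantumFieldTheory.Balaban1983to89.T4WilsonResponseJunction

/-!
# `Balaban1983to89.T4WilsonOddInsert` — ONE CONCRETE INVERSION-ODD INSERT, END TO END: the transverse link insert
# `y ↦ Re(su2Quat(y_b) · d)` (`Re d = 0`; e.g. the quaternion coordinate `(su2Quat y_b).imI`, `d = −i`) has its four
# insert binders of `T4WilsonResponseJunction` (measurable `hBm` ∕ bounded `hR` ∕ chart-`C¹` with an EXPLICIT gradient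
# budget `hBg` ∕ bondwise inversion-odd `hodd`) DISCHARGED BY PROOF, so that the (CM) channel bound (I6) in the (β)
# currency about the FLAT field (`condMean_channel_wilson_disjoint_flat`, §7 there) becomes a CLOSED statement whose
# only hypotheses are `PlaqDisjoint s`, the window numbers, `0 ≤ β`, `0 ≤ w`, `Re dᵢ = 0 ∧ ‖dᵢ‖ ≤ 1` on `T` and the
# coefficient bound (cell T4, node O3b; row `T4-O3.E-i′-β-CONVRESP-ODDINSERT*`, Q24(a) self-row of lineage pv16
# generation 20)

HONEST FRAMING.  Audit cell `pub-balaban`, unit `b2b-balaban-pv16-g20` (SURGE NODE PROVER #16; companion record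
`HOME/t4/T4-EST-O3Ei1.md` §4m).  The cell's T4 target is the existence and uniqueness of the continuum limit of
unit-scale averaged loop expectations on a FINITE torus, with Bałaban's densities as GIVEN data satisfying the printed
end statement (B) as a HYPOTHESIS; it is NOT an infinite-volume statement, NOT a mass gap, NOT the Clay problem, and
this module is NOT progress on any summit.  Value = kernel-checked bookkeeping and nothing more: multivariable calculus
of one explicit function and the specialisation of theorems already in the tree.  `T4WilsonResponseJunction` (v1.1,
p192183) proved the (CM) channel bound of route (R) for the `k = 0` `SU(2)` Wilson Gibbs law windowed gnomonically
about the FLAT field on a plaquette-disjoint link set `s`, for an ABSTRACT family of inserts `B : (s → SU2) → ι → ℝ`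
subject to four binders: `hBm` (measurable), `hR` (bounded), `hBg` (a `C¹` representative of `x ↦ B(u₀ ·_s P(1,x))`
on the window cube with `|∇|² ≤ L²`) and `hodd` (odd under the inversion of one fibre variable).  No insert had been
run through them.  THIS MODULE does it for the simplest physically meaningful family — the TRANSVERSE LINK INSERTS
`transverseInsert bd dir y i = Re(su2Quat(y (bd i)) · dir i)`, one link `bd i ∈ s` and one direction `dir i ∈ ℍ` per
index (for `dir i = −i` this is the coordinate `(su2Quat (y (bd i))).imI`): (i) they are measurable and bounded by
`‖dir i‖` (§4); (ii) they are odd under `bondReflect 1 (bd i)` as soon as `Re(dir i) = 0` (§4;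
`su2Quat g⁻¹ = star (su2Quat g)`); (iii) in the gnomonic fibre chart about ANY reference `u₀` their reading is the
profile `F_{−Re c, −Im c} ∘ π_{bd i}`, `c = dir i · su2Quat(u₀ (bd i))` (`T4GnomonicWilsonHessian.re_su2Quat_gnoChart_mul`
and the block projection `π_b` of `T4WilsonDisjointLinks`), a GLOBALLY `C¹` function whose gradient on the window cube
`[−S,S]ⁿ` is at most `1 + ρ + ρ²` for `3S² ≤ ρ²`, `‖dir i‖ ≤ 1` (§3–§4), and at the FLAT reference (`c = dir i`,
`Re c = 0`) at most `1` EVERYWHERE (§1: at `A = 0` the profile `F_{0,B}` is globally `|B|`-Lipschitz); (iv) hence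
(§5) the junction theorems specialise BY NAME: `MeanLipschitz` about a general reference with modulus
`respSlope·((1+ρ+ρ²)/√respLam)` (the reference small field `hsf₀` stays a binder there), and about the flat field the
CLOSED statements `condMeanSuppression_wilson_transverse_flat` ∕ `condMean_channel_wilson_transverse_flat` with
modulus `respSlope·(1/√respLam)` and NO insert binder, NO field binder, NO `MeanVanishes` binder; (v) the literal
`imI`-coordinate corollary `condMean_channel_wilson_imI_flat` and the one-link instance.  What REMAINS a binder after
this module, honestly: the window numbers `0 < S < S′ ≤ 1`, `0 ≤ ρ ≤ 1/4`, `3·S′² ≤ ρ²` ((USE-c)), the normalisation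
`Re(dir i) = 0 ∧ ‖dir i‖ ≤ 1`, the coefficient bound `A`, and — the substantive located item, untouched — that the
live set of the consumer's ACTUAL term lies inside `stapleLive s 1 0` UNIFORMLY in the step index (EST; for `k ≥ 1`
the exponent is not the bare Wilson action and nothing here applies verbatim).

CITATION HEADER.  Nothing of T. Bałaban's series (CMP 1984–89) is newly read, quoted or attributed in this module.  The
only contact with print is CONTEXT through tree headers quoted EARLIER and not re-quoted here (the Wilson action
`wilsonAction w` models [Balaban1987RG1] (0.2) p. 252, `Setup`; the term structure `condLaw` ∕ `condMean` ∕
`linDensity` ∕ `fibreReading` ∕ `MeanLipschitz` ∕ `CondMeanSuppression` is the cell's typed model of one term of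
[Balaban1989LargeFieldI] (0.3), `B15BasicStep` ∕ `T4DressingDefect` ∕ `T4CondMeanChannel` ∕ `T4FirstOrderSize`).
ABSOLUTE RULE honoured: no programme-internal statement is an input; every declaration below is [folklore]
(Cauchy–Schwarz, the chain rule through a coordinate projection, `‖su2Quat U‖ = 1`, measurability of a continuous real
function of one coordinate, specialisation of theorems already in the tree).

NEW vs PRINTED-TYPE.  PRINTED-TYPE: none newly used.  CELL MODEL typed EARLIER (by name): the junction theorems
`T4WilsonResponseJunction.meanLipschitz_wilson_disjoint` ∕ `condMeanSuppression_wilson_disjoint_flat` ∕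
`condMean_channel_wilson_disjoint_flat` ∕ `bondReflect_one_apply_self`, the profile calculus
`T4GnomonicWilsonHessian.gnoProfile` ∕ `fderiv_gnoProfile` ∕ `sq_fderiv_gnoProfile_le` ∕
`coordGradient_sq_le_of_sq_fderiv_le` ∕ `imVec` ∕ `re_su2Quat_gnoChart_mul`, the block projection
`T4WilsonDisjointLinks.blockProj` ∕ `sum_blockProj_dotProduct` ∕ `blockProj_mem_cube` ∕
`gnoFibreChart_eq_gnoChart_blockProj`, the quaternion bounds `T4WilsonDatumBounds.re_sq_le_norm_sq` ∕
`abs_re_su2Quat_mul_le`, the chart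
`T4CubeChartGnomonic.gnoFibreChart` ∕ `bondCoordEquiv` ∕ `qI`, the quaternion model `QuantumLattice.su2Quat` ∕
`norm_su2Quat` ∕ `T4HaarSU2Translate.continuous_su2Quat` ∕ `su2Quat_one` ∕ `T4WilsonLinkAffine.su2Quat_inv`, the bond
reflection `T4SeparableFibreExpansion.bondReflect`.  NEW HERE (kernel, [folklore]): §1 the global Lipschitz bound of
the profile at `A = 0`, §2 the one-block composition calculus, §3 the quaternion identities, §4 the
transverse insert and its four binders, §5 the specialised junction theorems and instances.

WHAT IS PROVED (all [folklore]; no `sorry`, no new axiom):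
§1 `gnoProfile_neg` (`F_{−A,−B} = −F_{A,B}`), `sq_fderiv_gnoProfile_zero_le` ((G1₀): `(DF_{0,B}(x) w)² ≤ (B·B)(w·w)`
   for ALL `x`), `coordGradient_gnoProfile_zero_sq_le` ((G2₀): `|∇F_{0,B}(x)|² ≤ b²` for `B·B ≤ b²`, all `x`).
§2 `blockProj_dotProduct_self_le` (`|π_b w|² ≤ |w|²`), `fderiv_comp_blockProj` (chain rule), `contDiff_comp_blockProj`,
   `coordGradient_comp_blockProj_sq_le` (`(Df(π_b x) v)² ≤ G²|v|² ∀ v ⟹ |∇(f ∘ π_b)(x)|² ≤ G²`).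
§3 `re_star_mul_of_re_eq_zero` (`Re(star q · d) = −Re(q · d)` for `Re d = 0`), `imVec_dotProduct_self_le_one`,
   `abs_re_le_one` (`‖c‖ ≤ 1`), `re_mul_neg_qI` (`Re(q · (−i)) = q.imI`), `re_neg_qI`, `norm_qI`, `norm_neg_qI`.
§4 `transverseInsert bd dir : (s → SU2) → ι → ℝ`, `transverseInsert_apply`, `transverseInsert_neg_qI` (the `imI`
   reading), `measurable_transverseInsert` (hBm), `abs_transverseInsert_le` ∕ `norm_transverseInsert_le` (hR with
   `R = ‖dir i‖`, via `T4WilsonDatumBounds.abs_re_su2Quat_mul_le`), `transverseInsert_bondReflect_one` (hodd from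
   `Re(dir i) = 0`), `transverseInsert_gnoFibreChart` (the chart reading
   `F_{−Re c,−Im c}(π_{bd i} x)`, `c = dir i · su2Quat(u₀ (bd i))`), `transverseInsert_gnoFibreChart_one` (`c = dir i`),
   `chartRep_transverseInsert_of_eq` ∕ `chartRep_transverseInsert` (hBg about ANY `u₀` on `cube n S` with
   `L = 1 + ρ + ρ²` from `‖dir i‖ ≤ 1`, `0 ≤ ρ`, `3S² ≤ ρ²`), `chartRep_transverseInsert_flat` (hBg about `u₀ = 1` with
   `L = 1` from `Re(dir i) = 0`, `‖dir i‖ ≤ 1` — no window condition).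
§5 `meanLipschitz_wilson_transverse` ((J1) about a general `u₀`: binders `hε0`, `hsf₀` KEPT; modulus
   `respSlope·((1+ρ+ρ²)/√respLam)`), `condMeanSuppression_wilson_transverse_flat` and
   `condMean_channel_wilson_transverse_flat` ((J2)∕(J3) about `u₀ = 1`, `ε = 0`: hypotheses `PlaqDisjoint s`,
   `0 < S < S′ ≤ 1`, `0 ≤ β`, `0 ≤ w`, `0 ≤ ρ ≤ 1/4`, `3S′² ≤ ρ²`, `∀ i ∈ T, Re(dir i) = 0 ∧ ‖dir i‖ ≤ 1` (and for (J3)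
   `∀ i ∈ T, ‖a i‖ ≤ A`) ONLY; conclusion of (J3):
   `|E^{W}_s[linDensity t T a (fibreReading s (transverseInsert bd dir)) | V_out]| ≤ |t|·(|T|·A·(respSlope·(1/√respLam)·(1/8)))`
   for every `V` with `Σ_{b∈s} stapleDist b 1 V ≤ 1/8`, `W = χ_{s,1,S}·e^{−β A_w}`), `condMean_channel_wilson_imI_flat`
   (`ι := s`, inserts `y ↦ (su2Quat (y b)).imI`), and the one-link `example` (`s = {b}`, `plaqDisjoint_singleton`).

HONEST SCOPE.  (a) `k = 0`, `G = SU(2)`, bare Wilson exponent, PLAQUETTE-DISJOINT `s`, and for the closed statements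
the FLAT reference `u₀ = 1` only (about `u₀ ≠ 1` the chart-`C¹` budget `1 + ρ + ρ²` is proved but `hsf₀` and
`MeanVanishes` stay binders of the junction).  (b) One link per index: multi-link inserts (e.g. `Re tr` of a path
through several links of `s`) are sums of products of such readings; their budgets are NOT derived here.  (c) The
normalisation `‖dir i‖ ≤ 1` puts the size of the insert into the coefficients `a i` (bound `A`).  (d) The consumer's
real live set is `liveSet s W′` of ITS term `W′`; that it sits inside `stapleLive s 1 0`, uniformly in `k`, is the
located estimate (EST) and is NOT claimed.  (e) Nothing printed is asserted; value = kernel certificate, NOT summit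
progress.
-/

noncomputable section

open _root_.MeasureTheory
open scoped BigOperators Quaternion

namespace Literature.MathematicalPhysics.QuantumFieldTheory.Balaban1983to89.T4WilsonOddInsert

open B15.BasicStep T4DressingDefect T4FirstOrderSize
open Literature.MathematicalPhysics.QuantumLattice (su2Quat norm_su2Quat)
open Literature.Probability.Distributions (coordGradient)
open T4HaarSU2Translate (su2Quat_one continuous_su2Quat)
open T4WilsonLinkAffine (su2Quat_inv IsLetter)
open T4CubePoincare (cube mem_cube_iff)
open T4CubeChartGnomonic (SU2 gnoChart gnoFibreChart windowDensity bondCoordEquiv qI)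
open T4GnomonicWilsonHessian (gnoProfile imVec fderiv_gnoProfile dotProduct_sq_le coordGradient_sq_le_of_sq_fderiv_le
  sq_fderiv_gnoProfile_le re_su2Quat_gnoChart_mul imVec_dotProduct_self one_add_dotProduct_self_pos contDiff_gnoProfile
  dotProduct_self_le_of_mem_cube)
open T4WilsonDatumBounds (re_sq_le_norm_sq abs_re_su2Quat_mul_le)
open T4WilsonDisjointLinks (PlaqDisjoint plaqDisjoint_singleton blockProj blockProj_apply sum_blockProj_dotProduct
  blockProj_mem_cube gnoFibreChart_eq_gnoChart_blockProj)
open T4WilsonStapleDeviation (stapleDist)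
open T4SeparableFibreExpansion (bondReflect)
open T4CondMeanChannel (linDensity fibreReading)
open T4WilsonResponseJunction (respLam respSlope stapleLive meanLipschitz_wilson_disjoint
  condMeanSuppression_wilson_disjoint_flat condMean_channel_wilson_disjoint_flat bondReflect_one_apply_self)

/-! ## §1  The profile at `A = 0` is globally `|B|`-Lipschitz -/

section Profile

variable {n : ℕ}

/-- `F_{−A,−B} = −F_{A,B}`. [folklore] -/
theorem gnoProfile_neg (A : ℝ) (B x : Fin n → ℝ) : gnoProfile (-A) (-B) x = -gnoProfile A B x := by
  simp only [gnoProfile, neg_dotProduct, sub_neg_eq_add]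
  ring

/-- **(G1₀) AT `A = 0` THE PROFILE IS GLOBALLY `|B|`-LIPSCHITZ**: `(DF_{0,B}(x) w)² ≤ (B·B)(w·w)` for ALL `x` — with
`a = 1 + x·x` and `v = a B − (B·x) x` one has `DF_{0,B}(x) w = v·w/(a√a)` and `|v|² = a²|B|² − (B·x)²(a+1) ≤ a³|B|²`
(Cauchy–Schwarz). [folklore] -/
theorem sq_fderiv_gnoProfile_zero_le (B x w : Fin n → ℝ) :
    (fderiv ℝ (gnoProfile 0 B) x w) ^ 2 ≤ (B ⬝ᵥ B) * (w ⬝ᵥ w) := by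
  rw [fderiv_gnoProfile, sub_zero]
  have ha := one_add_dotProduct_self_pos x
  have hxx : 0 ≤ x ⬝ᵥ x := by simpa using dotProduct_star_self_nonneg x
  have hc : 0 ≤ w ⬝ᵥ w := by simpa using dotProduct_star_self_nonneg w
  have hBB : 0 ≤ B ⬝ᵥ B := by simpa using dotProduct_star_self_nonneg B
  have hsq : Real.sqrt (1 + x ⬝ᵥ x) ^ 2 = 1 + x ⬝ᵥ x := Real.sq_sqrt ha.le
  have hs : 0 < Real.sqrt (1 + x ⬝ᵥ x) := Real.sqrt_pos.2 ha
  have hcs := dotProduct_sq_le ((1 + x ⬝ᵥ x) • B - (B ⬝ᵥ x) • x) w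
  have hv1 : ((1 + x ⬝ᵥ x) • B - (B ⬝ᵥ x) • x) ⬝ᵥ w = (1 + x ⬝ᵥ x) * (B ⬝ᵥ w) - (B ⬝ᵥ x) * (x ⬝ᵥ w) := by
    rw [sub_dotProduct, smul_dotProduct, smul_dotProduct, smul_eq_mul, smul_eq_mul]
  have hv2 : ((1 + x ⬝ᵥ x) • B - (B ⬝ᵥ x) • x) ⬝ᵥ ((1 + x ⬝ᵥ x) • B - (B ⬝ᵥ x) • x)
      = (1 + x ⬝ᵥ x) ^ 2 * (B ⬝ᵥ B) - (B ⬝ᵥ x) ^ 2 * ((1 + x ⬝ᵥ x) + 1) := by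
    rw [sub_dotProduct, dotProduct_sub, dotProduct_sub, smul_dotProduct, smul_dotProduct, smul_dotProduct,
      smul_dotProduct, dotProduct_smul, dotProduct_smul, dotProduct_smul, dotProduct_smul, dotProduct_comm x B]
    simp only [smul_eq_mul]
    ring
  rw [hv1, hv2] at hcs
  have hexp : (B ⬝ᵥ w) / Real.sqrt (1 + x ⬝ᵥ x) - (B ⬝ᵥ x) * (x ⬝ᵥ w) / ((1 + x ⬝ᵥ x) * Real.sqrt (1 + x ⬝ᵥ x))
      = ((1 + x ⬝ᵥ x) * (B ⬝ᵥ w) - (B ⬝ᵥ x) * (x ⬝ᵥ w)) / ((1 + x ⬝ᵥ x) * Real.sqrt (1 + x ⬝ᵥ x)) := by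
    rw [← mul_div_mul_left (B ⬝ᵥ w) (Real.sqrt (1 + x ⬝ᵥ x)) ha.ne', sub_div]
  rw [hexp, div_pow, mul_pow, hsq, div_le_iff₀ (by positivity)]
  nlinarith [mul_nonneg (mul_nonneg (sq_nonneg (B ⬝ᵥ x)) hc) (by linarith : (0 : ℝ) ≤ 1 + x ⬝ᵥ x + 1),
    mul_nonneg (mul_nonneg hBB hc) (mul_nonneg (sq_nonneg (1 + x ⬝ᵥ x)) hxx)]

/-- **(G2₀)** `|∇F_{0,B}(x)|² ≤ b²` for `B·B ≤ b²`, at EVERY `x` (no window). [folklore] -/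
theorem coordGradient_gnoProfile_zero_sq_le {b : ℝ} {B : Fin n → ℝ} (hB : B ⬝ᵥ B ≤ b ^ 2) (x : Fin n → ℝ) :
    coordGradient (gnoProfile 0 B) x ⬝ᵥ coordGradient (gnoProfile 0 B) x ≤ b ^ 2 :=
  coordGradient_sq_le_of_sq_fderiv_le fun w =>
    (sq_fderiv_gnoProfile_zero_le B x w).trans
      (mul_le_mul_of_nonneg_right hB (by simpa using dotProduct_star_self_nonneg w))

end Profile

/-! ## §2  One-block composition: `x ↦ f(π_b x)` -/

section Blocks

variable {κ : Type*} {m n : ℕ}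

/-- `|π_b w|² ≤ |w|²` (the blocks are orthogonal and exhaust `ℝⁿ`). [folklore] -/
theorem blockProj_dotProduct_self_le [Fintype κ] (e : κ × Fin m ≃ Fin n) (b : κ) (w : Fin n → ℝ) :
    blockProj e b w ⬝ᵥ blockProj e b w ≤ w ⬝ᵥ w := by
  rw [← sum_blockProj_dotProduct e w w]
  exact Finset.single_le_sum (f := fun b' => blockProj e b' w ⬝ᵥ blockProj e b' w)
    (fun b' _ => by simpa using dotProduct_star_self_nonneg (blockProj e b' w)) (Finset.mem_univ b)

/-- Chain rule through a block projection: `D(f ∘ π_b)(x) w = Df(π_b x)(π_b w)`. [folklore] -/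
theorem fderiv_comp_blockProj {f : (Fin m → ℝ) → ℝ} (hf : Differentiable ℝ f) (e : κ × Fin m ≃ Fin n) (b : κ)
    (x w : Fin n → ℝ) :
    fderiv ℝ (fun y => f (blockProj e b y)) x w = fderiv ℝ f (blockProj e b x) (blockProj e b w) := by
  rw [show (fun y => f (blockProj e b y)) = f ∘ ⇑(blockProj e b) from rfl,
    fderiv_comp x (hf _) (blockProj e b).differentiableAt, (blockProj e b).fderiv, ContinuousLinearMap.comp_apply]

/-- `f ∘ π_b` is as smooth as `f`. [folklore] -/
theorem contDiff_comp_blockProj {f : (Fin m → ℝ) → ℝ} {k : WithTop ℕ∞} (hf : ContDiff ℝ k f)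
    (e : κ × Fin m ≃ Fin n) (b : κ) : ContDiff ℝ k fun y => f (blockProj e b y) :=
  hf.comp (blockProj e b).contDiff

/-- **THE GRADIENT OF A ONE-BLOCK FUNCTION**: `(Df(π_b x) v)² ≤ G²|v|²` for all `v` gives `|∇(f ∘ π_b)(x)|² ≤ G²`.
[folklore] -/
theorem coordGradient_comp_blockProj_sq_le [Fintype κ] (e : κ × Fin m ≃ Fin n) (b : κ) {f : (Fin m → ℝ) → ℝ}
    (hf : Differentiable ℝ f) {G : ℝ} {x : Fin n → ℝ}
    (hG : ∀ v, (fderiv ℝ f (blockProj e b x) v) ^ 2 ≤ G ^ 2 * (v ⬝ᵥ v)) :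
    coordGradient (fun y => f (blockProj e b y)) x ⬝ᵥ coordGradient (fun y => f (blockProj e b y)) x ≤ G ^ 2 :=
  coordGradient_sq_le_of_sq_fderiv_le fun w => by
    rw [fderiv_comp_blockProj hf]
    exact (hG _).trans (mul_le_mul_of_nonneg_left (blockProj_dotProduct_self_le e b w) (sq_nonneg G))

end Blocks

/-! ## §3  Quaternion facts -/

section Quat

/-- `Re(star q · d) = −Re(q · d)` when `Re d = 0`. [folklore] -/
theorem re_star_mul_of_re_eq_zero (q d : ℍ) (hd : d.re = 0) : (star q * d).re = -(q * d).re := by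
  simp only [Quaternion.re_mul, Quaternion.re_star, Quaternion.imI_star, Quaternion.imJ_star, Quaternion.imK_star, hd]
  ring

/-- `‖c‖ ≤ 1 ⟹ |Im c|² ≤ 1`. [folklore] -/
theorem imVec_dotProduct_self_le_one {c : ℍ} (hc : ‖c‖ ≤ 1) : imVec c ⬝ᵥ imVec c ≤ 1 ^ 2 := by
  rw [imVec_dotProduct_self, one_pow]
  nlinarith [norm_nonneg c, sq_nonneg c.re]

/-- `‖c‖ ≤ 1 ⟹ |Re c| ≤ 1` (`T4WilsonDatumBounds.re_sq_le_norm_sq`). [folklore] -/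
theorem abs_re_le_one {c : ℍ} (hc : ‖c‖ ≤ 1) : |c.re| ≤ 1 :=
  (abs_le_of_sq_le_sq (by simpa using re_sq_le_norm_sq c) (norm_nonneg c)).trans hc

/-- The `imI`-coordinate as a transverse reading: `Re(q · (−i)) = q.imI`. [folklore] -/
theorem re_mul_neg_qI (q : ℍ) : (q * -qI).re = q.imI := by
  simp [qI, Quaternion.re_mul]

/-- `Re(−i) = 0`. [folklore] -/
theorem re_neg_qI : (-qI).re = 0 := by
  simp [qI]

/-- `‖i‖ = 1`. [folklore] -/
theorem norm_qI : ‖qI‖ = 1 := by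
  have h : ‖qI‖ ^ 2 = 1 := by
    rw [sq, ← Quaternion.normSq_eq_norm_mul_self, Quaternion.normSq_def']
    simp [qI]
  rw [← Real.sqrt_sq (norm_nonneg qI), h, Real.sqrt_one]

/-- `‖−i‖ = 1`. [folklore] -/
theorem norm_neg_qI : ‖-qI‖ = 1 := by
  rw [norm_neg, norm_qI]

end Quat

/-! ## §4  The transverse link insert and its four binders -/

section Insert

variable {P : Params} {j : ℕ} {s : Finset (PBond P j)} {ι : Type*}

/-- **THE TRANSVERSE LINK INSERT**: index `i` reads the link `bd i ∈ s` in the direction `dir i ∈ ℍ`,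
`y ↦ Re(su2Quat(y (bd i)) · dir i)`.  For `dir i = −i` this is the quaternion coordinate `(su2Quat (y (bd i))).imI`
(`transverseInsert_neg_qI`). [folklore] -/
def transverseInsert (bd : ι → ↥s) (dir : ι → ℍ) : (↥s → SU2) → ι → ℝ :=
  fun y i => (su2Quat (y (bd i)) * dir i).re

/-- Unfolding lemma. [folklore] -/
theorem transverseInsert_apply (bd : ι → ↥s) (dir : ι → ℍ) (y : ↥s → SU2) (i : ι) :
    transverseInsert bd dir y i = (su2Quat (y (bd i)) * dir i).re := rfl

/-- The `imI` reading: direction `−i`. [folklore] -/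
theorem transverseInsert_neg_qI (bd : ι → ↥s) (y : ↥s → SU2) (i : ι) :
    transverseInsert bd (fun _ => -qI) y i = (su2Quat (y (bd i))).imI :=
  re_mul_neg_qI _

/-- **(hBm)** the transverse insert is measurable in the fibre variable: the continuous REAL function
`U ↦ Re(su2Quat U · dir i)` of the single coordinate `y (bd i)` (no measurable structure on `ℍ` is used). [folklore] -/
theorem measurable_transverseInsert (bd : ι → ↥s) (dir : ι → ℍ) (i : ι) :
    Measurable fun y : ↥s → SU2 => transverseInsert bd dir y i := by
  have h : Measurable fun U : SU2 => (su2Quat U * dir i).re :=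
    (Quaternion.continuous_re.comp (continuous_su2Quat.mul continuous_const)).measurable
  exact h.comp (measurable_pi_apply (bd i))

/-- **(hR)** `|transverseInsert bd dir y i| ≤ ‖dir i‖`. [folklore] -/
theorem abs_transverseInsert_le (bd : ι → ↥s) (dir : ι → ℍ) (y : ↥s → SU2) (i : ι) :
    |transverseInsert bd dir y i| ≤ ‖dir i‖ :=
  abs_re_su2Quat_mul_le _ _

/-- **(hR)**, norm form. [folklore] -/
theorem norm_transverseInsert_le (bd : ι → ↥s) (dir : ι → ℍ) (y : ↥s → SU2) (i : ι) :
    ‖transverseInsert bd dir y i‖ ≤ ‖dir i‖ := by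
  rw [Real.norm_eq_abs]
  exact abs_transverseInsert_le bd dir y i

variable [DecidableEq (PBond P j)]

/-- **(hodd)** the transverse insert in a PURELY IMAGINARY direction is ODD under the flat bond reflection
`y_b ↦ y_b⁻¹` of its own link (`su2Quat g⁻¹ = star (su2Quat g)`). [folklore] -/
theorem transverseInsert_bondReflect_one (bd : ι → ↥s) {dir : ι → ℍ} {i : ι} (hre : (dir i).re = 0)
    (y : ↥s → SU2) : transverseInsert bd dir (bondReflect 1 (bd i) y) i = -transverseInsert bd dir y i := by
  rw [transverseInsert_apply, transverseInsert_apply, bondReflect_one_apply_self, su2Quat_inv]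
  exact re_star_mul_of_re_eq_zero _ _ hre

variable {n : ℕ} {u₀ : GaugeField P j SU2}

omit [DecidableEq (PBond P j)] in
/-- **THE CHART READING** of the transverse insert about ANY reference: `F_{−Re c, −Im c}(π_{bd i} x)`,
`c = dir i · su2Quat(u₀ (bd i))` (`gnoFibreChart_eq_gnoChart_blockProj`, `re_su2Quat_gnoChart_mul`). [folklore] -/
theorem transverseInsert_gnoFibreChart (e : ↥s × Fin 3 ≃ Fin n) (bd : ι → ↥s) (dir : ι → ℍ) (x : Fin n → ℝ)
    (i : ι) :
    transverseInsert bd dir (gnoFibreChart s u₀ e x) i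
      = gnoProfile (-(dir i * su2Quat (u₀ (bd i))).re) (-imVec (dir i * su2Quat (u₀ (bd i))))
          (blockProj e (bd i) x) := by
  rw [transverseInsert_apply, gnoFibreChart_eq_gnoChart_blockProj, re_su2Quat_gnoChart_mul, gnoProfile_neg]

omit [DecidableEq (PBond P j)] in
/-- … about the FLAT reference: `F_{−Re(dir i), −Im(dir i)}(π_{bd i} x)`. [folklore] -/
theorem transverseInsert_gnoFibreChart_one (e : ↥s × Fin 3 ≃ Fin n) (bd : ι → ↥s) (dir : ι → ℍ) (x : Fin n → ℝ)
    (i : ι) :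
    transverseInsert bd dir (gnoFibreChart s (1 : GaugeField P j SU2) e x) i
      = gnoProfile (-(dir i).re) (-imVec (dir i)) (blockProj e (bd i) x) := by
  have h1 : (1 : GaugeField P j SU2) ((bd i : ↥s) : PBond P j) = 1 := rfl
  rw [transverseInsert_gnoFibreChart, h1, su2Quat_one, mul_one]

omit [DecidableEq (PBond P j)] in
/-- **(hBg) ABOUT ANY REFERENCE**, datum form: if `dir i · su2Quat(u₀ (bd i)) = c` with `‖c‖ ≤ 1`, then on the cube
`[−S,S]ⁿ` with `3S² ≤ ρ²` the chart reading has the global `C¹` representative `F_{−Re c,−Im c} ∘ π_{bd i}` with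
`|∇|² ≤ (1 + ρ + ρ²)²` (`sq_fderiv_gnoProfile_le` with `b = 1`, `|A| ≤ 1`, `|π_b x|² ≤ 3S² ≤ ρ²`). [folklore] -/
theorem chartRep_transverseInsert_of_eq (e : ↥s × Fin 3 ≃ Fin n) (bd : ι → ↥s) {dir : ι → ℍ} {i : ι} {c : ℍ}
    (hc : dir i * su2Quat (u₀ (bd i)) = c) (hc1 : ‖c‖ ≤ 1) {S ρ : ℝ} (hρ : 0 ≤ ρ) (h3S : 3 * S ^ 2 ≤ ρ ^ 2) :
    ∃ g : (Fin n → ℝ) → ℝ, ContDiff ℝ 1 g ∧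
      (∀ x ∈ cube n S, g x = transverseInsert bd dir (gnoFibreChart s u₀ e x) i) ∧
      ∀ x ∈ cube n S, coordGradient g x ⬝ᵥ coordGradient g x ≤ (1 + ρ + ρ ^ 2) ^ 2 := by
  have hB : (-imVec c) ⬝ᵥ (-imVec c) ≤ 1 ^ 2 := by
    rw [neg_dotProduct, dotProduct_neg, neg_neg]
    exact imVec_dotProduct_self_le_one hc1
  have hA : |(-c.re)| ≤ 1 := by
    rw [abs_neg]
    exact abs_re_le_one hc1
  have hdiff : Differentiable ℝ (gnoProfile (-c.re) (-imVec c)) :=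
    (contDiff_gnoProfile (-c.re) (-imVec c) (m := 1)).differentiable one_ne_zero
  refine ⟨fun x => gnoProfile (-c.re) (-imVec c) (blockProj e (bd i) x),
    contDiff_comp_blockProj (contDiff_gnoProfile _ _) e (bd i), fun x _ => ?_, fun x hx => ?_⟩
  · rw [transverseInsert_gnoFibreChart, hc]
  · have hxb : blockProj e (bd i) x ⬝ᵥ blockProj e (bd i) x ≤ ρ ^ 2 := by
      have h := dotProduct_self_le_of_mem_cube (blockProj_mem_cube e (bd i) hx)
      have h3 : ((3 : ℕ) : ℝ) * S ^ 2 = 3 * S ^ 2 := by norm_num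
      linarith
    refine coordGradient_comp_blockProj_sq_le e (bd i) hdiff fun v => ?_
    refine (sq_fderiv_gnoProfile_le zero_le_one hB hρ hxb v).trans (mul_le_mul_of_nonneg_right ?_ ?_)
    · have h0 : 0 ≤ 1 * (1 + ρ ^ 2) + |(-c.re)| * ρ := by positivity
      have hle : 1 * (1 + ρ ^ 2) + |(-c.re)| * ρ ≤ 1 + ρ + ρ ^ 2 := by nlinarith [abs_nonneg (-c.re)]
      exact pow_le_pow_left₀ h0 hle 2
    · simpa using dotProduct_star_self_nonneg v

omit [DecidableEq (PBond P j)] in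
/-- **(hBg) ABOUT ANY REFERENCE**: for `‖dir i‖ ≤ 1`, `0 ≤ ρ`, `3S² ≤ ρ²` the chart reading of the transverse insert
on `cube n S` has a global `C¹` representative with `|∇|² ≤ (1 + ρ + ρ²)²`. [folklore] -/
theorem chartRep_transverseInsert (e : ↥s × Fin 3 ≃ Fin n) (bd : ι → ↥s) {dir : ι → ℍ} {i : ι} (hdir : ‖dir i‖ ≤ 1)
    {S ρ : ℝ} (hρ : 0 ≤ ρ) (h3S : 3 * S ^ 2 ≤ ρ ^ 2) :
    ∃ g : (Fin n → ℝ) → ℝ, ContDiff ℝ 1 g ∧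
      (∀ x ∈ cube n S, g x = transverseInsert bd dir (gnoFibreChart s u₀ e x) i) ∧
      ∀ x ∈ cube n S, coordGradient g x ⬝ᵥ coordGradient g x ≤ (1 + ρ + ρ ^ 2) ^ 2 := by
  refine chartRep_transverseInsert_of_eq e bd rfl ?_ hρ h3S
  rw [norm_mul, norm_su2Quat, mul_one]
  exact hdir

omit [DecidableEq (PBond P j)] in
/-- **(hBg) ABOUT THE FLAT REFERENCE, `L = 1`, NO WINDOW CONDITION**: for `Re(dir i) = 0`, `‖dir i‖ ≤ 1` the chart
reading about `u₀ = 1` is `F_{0, −Im(dir i)} ∘ π_{bd i}`, globally `C¹` with `|∇|² ≤ 1` EVERYWHERE ((G1₀)).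
[folklore] -/
theorem chartRep_transverseInsert_flat (e : ↥s × Fin 3 ≃ Fin n) (bd : ι → ↥s) {dir : ι → ℍ} {i : ι}
    (hre : (dir i).re = 0) (hdir : ‖dir i‖ ≤ 1) (S : ℝ) :
    ∃ g : (Fin n → ℝ) → ℝ, ContDiff ℝ 1 g ∧
      (∀ x ∈ cube n S, g x = transverseInsert bd dir (gnoFibreChart s (1 : GaugeField P j SU2) e x) i) ∧
      ∀ x ∈ cube n S, coordGradient g x ⬝ᵥ coordGradient g x ≤ (1 : ℝ) ^ 2 := by
  have hB : (-imVec (dir i)) ⬝ᵥ (-imVec (dir i)) ≤ 1 ^ 2 := by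
    rw [neg_dotProduct, dotProduct_neg, neg_neg]
    exact imVec_dotProduct_self_le_one hdir
  have hdiff : Differentiable ℝ (gnoProfile 0 (-imVec (dir i))) :=
    (contDiff_gnoProfile 0 (-imVec (dir i)) (m := 1)).differentiable one_ne_zero
  refine ⟨fun x => gnoProfile 0 (-imVec (dir i)) (blockProj e (bd i) x),
    contDiff_comp_blockProj (contDiff_gnoProfile _ _) e (bd i), fun x _ => ?_, fun x _ => ?_⟩
  · rw [transverseInsert_gnoFibreChart_one, hre, neg_zero]
  · exact coordGradient_comp_blockProj_sq_le e (bd i) hdiff fun v =>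
      (sq_fderiv_gnoProfile_zero_le _ _ v).trans
        (mul_le_mul_of_nonneg_right hB (by simpa using dotProduct_star_self_nonneg v))

end Insert

/-! ## §5  The junction theorems for the transverse insert; the CLOSED channel about the flat field -/

section Junction

variable {P : Params} {j : ℕ} [DecidableEq (PBond P j)] {s : Finset (PBond P j)} {u₀ : GaugeField P j SU2}
variable {ε S : ℝ}

/-- **(J1) FOR THE TRANSVERSE INSERT, ANY REFERENCE.**  On a plaquette-disjoint `s`, with the window numbers, the
reference small field `hsf₀` (KEPT) and `‖dir i‖ ≤ 1` on `T`: the conditional means of the transverse inserts are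
`MeanLipschitz` on `stapleLive s u₀ ε` with modulus `respSlope·((1+ρ+ρ²)/√respLam)` — `meanLipschitz_wilson_disjoint`
with `e := bondCoordEquiv s`, `hBm`, `hBg` (`L = 1+ρ+ρ²`), `hR` (`R = 1`) DISCHARGED. [folklore] -/
theorem meanLipschitz_wilson_transverse {ι : Type*} (hdis : PlaqDisjoint s) (hS : 0 < S) {S' : ℝ} (hSS' : S < S')
    (hS'1 : S' ≤ 1) {β w : ℝ} (hβ : 0 ≤ β) (hw : 0 ≤ w) (hε0 : 0 ≤ ε)
    (hsf₀ : ∀ b ∈ s, ∀ p, IsLetter b p → 1 - ε ≤ reTr (GaugeField.plaqHol u₀ p))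
    {ρ : ℝ} (hρ : 0 ≤ ρ) (hρ4 : ρ ≤ 1 / 4) (h3S : 3 * S' ^ 2 ≤ ρ ^ 2)
    (bd : ι → ↥s) {dir : ι → ℍ} {T : Finset ι} (hdir : ∀ i ∈ T, ‖dir i‖ ≤ 1) :
    MeanLipschitz (stapleLive s u₀ ε)
      (fun u i => ∫ y, transverseInsert bd dir y i
        ∂condLaw s (fun U => windowDensity s u₀ S U * Real.exp (-β * wilsonAction w U)) u)
      T u₀ (fun U => ∑ b : ↥s, stapleDist (b : PBond P j) u₀ U)
      (respSlope P β w ρ S' * ((1 + ρ + ρ ^ 2) / Real.sqrt (respLam P β w S'))) := by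
  have h3S0 : 3 * S ^ 2 ≤ ρ ^ 2 := by nlinarith [pow_le_pow_left₀ hS.le hSS'.le 2]
  exact meanLipschitz_wilson_disjoint hdis (bondCoordEquiv s) hS hSS' hS'1 hβ hw hε0 hsf₀ hρ hρ4 h3S
    (fun i _ => measurable_transverseInsert bd dir i) (by positivity)
    (fun i hi => chartRep_transverseInsert (bondCoordEquiv s) bd (hdir i hi) hρ h3S0)
    (R := 1) (fun i hi y => (norm_transverseInsert_le bd dir y i).trans (hdir i hi))

/-- **(J2) ABOUT THE FLAT FIELD FOR THE TRANSVERSE INSERT — CLOSED.**  On a plaquette-disjoint `s`, from the window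
numbers, `0 ≤ β`, `0 ≤ w` and `Re(dir i) = 0 ∧ ‖dir i‖ ≤ 1` on `T` ONLY: `CondMeanSuppression` on
`stapleLive s 1 0 = {u | Σ_{b∈s} stapleDist b 1 u ≤ 1/8}` with modulus `respSlope·(1/√respLam)`
(`condMeanSuppression_wilson_disjoint_flat` with all four insert binders discharged, `L = 1`). [folklore] -/
theorem condMeanSuppression_wilson_transverse_flat {ι : Type*} (hdis : PlaqDisjoint s) (hS : 0 < S) {S' : ℝ}
    (hSS' : S < S') (hS'1 : S' ≤ 1) {β w : ℝ} (hβ : 0 ≤ β) (hw : 0 ≤ w) {ρ : ℝ} (hρ : 0 ≤ ρ) (hρ4 : ρ ≤ 1 / 4)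
    (h3S : 3 * S' ^ 2 ≤ ρ ^ 2) (bd : ι → ↥s) {dir : ι → ℍ} {T : Finset ι}
    (hdir : ∀ i ∈ T, (dir i).re = 0 ∧ ‖dir i‖ ≤ 1) :
    CondMeanSuppression (stapleLive s (1 : GaugeField P j SU2) 0)
      (fun u i => ∫ y, transverseInsert bd dir y i ∂condLaw s
        (fun U => windowDensity s (1 : GaugeField P j SU2) S U * Real.exp (-β * wilsonAction w U)) u)
      T (fun U => ∑ b : ↥s, stapleDist (b : PBond P j) 1 U)
      (respSlope P β w ρ S' * (1 / Real.sqrt (respLam P β w S'))) :=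
  condMeanSuppression_wilson_disjoint_flat hdis (bondCoordEquiv s) hS hSS' hS'1 hβ hw hρ hρ4 h3S
    (fun i _ => measurable_transverseInsert bd dir i) zero_le_one
    (fun i hi => chartRep_transverseInsert_flat (bondCoordEquiv s) bd (hdir i hi).1 (hdir i hi).2 S)
    (R := 1) (fun i hi y => (norm_transverseInsert_le bd dir y i).trans (hdir i hi).2)
    (fun i hi => ⟨bd i, transverseInsert_bondReflect_one bd (hdir i hi).1⟩)

/-- **(J3) THE (CM) CHANNEL (I6) ABOUT THE FLAT FIELD FOR THE TRANSVERSE INSERT — CLOSED.**  On a plaquette-disjoint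
`s`, from the window numbers, `0 ≤ β`, `0 ≤ w`, `Re(dir i) = 0 ∧ ‖dir i‖ ≤ 1` on `T` and the coefficient bound ONLY:
for every exterior `V` with `Σ_{b∈s} stapleDist b 1 V ≤ 1/8`,
`|E^{W}_s[linDensity t T a (fibreReading s (transverseInsert bd dir)) | V_out]| ≤ |t|·(|T|·A·(respSlope·(1/√respLam)·(1/8)))`,
`W = χ_{s,1,S}·e^{−β A_w}` — NO insert binder, NO field binder, NO `MeanVanishes` binder.  The consumer's (EST) input
(its live set inside `stapleLive s 1 0`, uniformly in `k`) is NOT claimed. [folklore] -/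
theorem condMean_channel_wilson_transverse_flat {ι : Type*} (hdis : PlaqDisjoint s) (hS : 0 < S) {S' : ℝ}
    (hSS' : S < S') (hS'1 : S' ≤ 1) {β w : ℝ} (hβ : 0 ≤ β) (hw : 0 ≤ w) {ρ : ℝ} (hρ : 0 ≤ ρ) (hρ4 : ρ ≤ 1 / 4)
    (h3S : 3 * S' ^ 2 ≤ ρ ^ 2) (bd : ι → ↥s) {dir : ι → ℍ} {T : Finset ι}
    (hdir : ∀ i ∈ T, (dir i).re = 0 ∧ ‖dir i‖ ≤ 1) (t : ℝ) {a : ι → ℝ} {A : ℝ} (hA : ∀ i ∈ T, ‖a i‖ ≤ A) :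
    ∀ V ∈ stapleLive s (1 : GaugeField P j SU2) 0,
      |condMean s (fun U => windowDensity s (1 : GaugeField P j SU2) S U * Real.exp (-β * wilsonAction w U))
          (linDensity t T a (fibreReading s (transverseInsert bd dir))) V|
        ≤ |t| * ((T.card : ℝ) * A * (respSlope P β w ρ S' * (1 / Real.sqrt (respLam P β w S')) * (1 / 8))) :=
  condMean_channel_wilson_disjoint_flat hdis (bondCoordEquiv s) hS hSS' hS'1 hβ hw hρ hρ4 h3S
    (fun i _ => measurable_transverseInsert bd dir i) zero_le_one
    (fun i hi => chartRep_transverseInsert_flat (bondCoordEquiv s) bd (hdir i hi).1 (hdir i hi).2 S)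
    (R := 1) (fun i hi y => (norm_transverseInsert_le bd dir y i).trans (hdir i hi).2)
    (fun i hi => ⟨bd i, transverseInsert_bondReflect_one bd (hdir i hi).1⟩) t hA

/-- **THE `imI` COORDINATES OF THE LINKS OF `s`** (`ι := s`, `bd := id`, `dir := −i`): for every `T ⊆ s` and every
exterior `V` with `Σ_{b∈s} stapleDist b 1 V ≤ 1/8`,
`|E^{W}_s[linDensity t T a (U ↦ b ↦ (su2Quat (U b)).imI) | V_out]| ≤ |t|·(|T|·A·(respSlope·(1/√respLam)·(1/8)))` — a
statement with NO insert data at all. [folklore] -/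
theorem condMean_channel_wilson_imI_flat (hdis : PlaqDisjoint s) (hS : 0 < S) {S' : ℝ} (hSS' : S < S')
    (hS'1 : S' ≤ 1) {β w : ℝ} (hβ : 0 ≤ β) (hw : 0 ≤ w) {ρ : ℝ} (hρ : 0 ≤ ρ) (hρ4 : ρ ≤ 1 / 4)
    (h3S : 3 * S' ^ 2 ≤ ρ ^ 2) {T : Finset ↥s} (t : ℝ) {a : ↥s → ℝ} {A : ℝ} (hA : ∀ i ∈ T, ‖a i‖ ≤ A) :
    ∀ V ∈ stapleLive s (1 : GaugeField P j SU2) 0,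
      |condMean s (fun U => windowDensity s (1 : GaugeField P j SU2) S U * Real.exp (-β * wilsonAction w U))
          (linDensity t T a (fibreReading s fun (y : ↥s → SU2) (b : ↥s) => (su2Quat (y b)).imI)) V|
        ≤ |t| * ((T.card : ℝ) * A * (respSlope P β w ρ S' * (1 / Real.sqrt (respLam P β w S')) * (1 / 8))) := by
  have hB : transverseInsert (s := s) id (fun _ : ↥s => -qI) = fun y b => (su2Quat (y b)).imI :=
    funext fun y => funext fun b => re_mul_neg_qI _
  have h := condMean_channel_wilson_transverse_flat hdis hS hSS' hS'1 hβ hw hρ hρ4 h3S (id : ↥s → ↥s)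
    (dir := fun _ => -qI) (T := T) (fun _ _ => ⟨re_neg_qI, norm_neg_qI.le⟩) t hA
  rwa [hB] at h

/-- **ONE LINK, FULLY EXPLICIT** (`s = {b}`, `plaqDisjoint_singleton b`): the channel bound for the `imI` coordinate
of `U(b)` under the windowed Wilson law about the flat field, conditioned outside `b`, for every exterior `V` with
`stapleDist b 1 V ≤ 1/8` (up to the `Σ` over the singleton) — hypotheses: the window numbers, `0 ≤ β`, `0 ≤ w`, the
coefficient bound. [folklore] -/
example (b : PBond P j) (hS : 0 < S) {S' : ℝ} (hSS' : S < S') (hS'1 : S' ≤ 1) {β w : ℝ} (hβ : 0 ≤ β) (hw : 0 ≤ w)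
    {ρ : ℝ} (hρ : 0 ≤ ρ) (hρ4 : ρ ≤ 1 / 4) (h3S : 3 * S' ^ 2 ≤ ρ ^ 2) {T : Finset ↥({b} : Finset (PBond P j))}
    (t : ℝ) {a : ↥({b} : Finset (PBond P j)) → ℝ} {A : ℝ} (hA : ∀ i ∈ T, ‖a i‖ ≤ A) :
    ∀ V ∈ stapleLive {b} (1 : GaugeField P j SU2) 0,
      |condMean {b} (fun U => windowDensity {b} (1 : GaugeField P j SU2) S U * Real.exp (-β * wilsonAction w U))
          (linDensity t T a (fibreReading {b}
            fun (y : ↥({b} : Finset (PBond P j)) → SU2) (b' : ↥({b} : Finset (PBond P j))) => (su2Quat (y b')).imI)) V|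
        ≤ |t| * ((T.card : ℝ) * A * (respSlope P β w ρ S' * (1 / Real.sqrt (respLam P β w S')) * (1 / 8))) :=
  condMean_channel_wilson_imI_flat (plaqDisjoint_singleton b) hS hSS' hS'1 hβ hw hρ hρ4 h3S t hA

/-- Non-vacuity of the live set: the flat exterior itself (`Σ_b stapleDist b 1 1 = 0 ≤ 1/8`). [folklore] -/
example : (1 : GaugeField P j SU2) ∈ stapleLive s (1 : GaugeField P j SU2) 0 :=
  T4WilsonResponseJunction.self_mem_stapleLive.2 (by norm_num)

/-- Non-vacuity of the window numbers: `S = 1/8`, `S′ = 1/7`, `ρ = 1/4` satisfy `0 < S < S′ ≤ 1`, `0 ≤ ρ ≤ 1/4`,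
`3S′² ≤ ρ²` (`3/49 ≤ 1/16`). [folklore] -/
example : (0 : ℝ) < 1 / 8 ∧ (1 : ℝ) / 8 < 1 / 7 ∧ (1 : ℝ) / 7 ≤ 1 ∧ (0 : ℝ) ≤ 1 / 4 ∧ (1 : ℝ) / 4 ≤ 1 / 4 ∧
    3 * ((1 : ℝ) / 7) ^ 2 ≤ (1 / 4) ^ 2 := by norm_num

end Junction

end Literature.MathematicalPhysics.QuantumFieldTheory.Balaban1983to89.T4WilsonOddInsert

end
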